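import Summits.HubbardSuperconductivity.HubbardSuperconductivity.Theorems.AnisotropyChordTransferFibre3RowCCellSound
import Summits.HubbardSuperconductivity.HubbardSuperconductivity.Theorems.AnisotropyChordTransferFibre3N1RowCellSoundS

/-!
# Route `AnisotropyChord` / H0 rotor rung, row C (KT-2b) of the LEVEL-2 certificate: the FIRST-ORDER cell check and ★★★ its
# soundness — a passing check bounds the off-pole tail for ALL `L ≥ 128` on the cell

The row-C cell check of p1 g28 (`RowC.rowCCellCheck`, `…RowCExpr`) evaluates the row inequality
`rowCE = 9(√Chi + √Nhi)² − 48π⁴·b·η·(2ê₁ − τ)·τ ≤ 0` by ZERO-ORDER interval arithmetic on p2's final box of the `(ν, a)`-cell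
(extended by `x₄ = θ⁴S₂`, `k₁₁`, `k₂₀`); like the row-`N₁` cells it loses to `(ν, a)`-decorrelation (p1: "the pointwise truth is
≈ 15–20 % lower").  This file is the row-C analogue of `…N1RowCheckS/…N1RowCellSoundS`: the SAME literal staged box and the SAME
22 part data of a first-order row-`N₁` cell (`PD`, `PartsOK`, `endsOfParts` — only the `P̂` and `Q̂₁` data enter `τ`) feed the
row-C final-stage environment `envR` (p2's final environment `envF` on indices `< 10`, the still coordinates `x₄ ∈ c.bS2`,
`k₁₁ ∈ k11I`, `k₂₀ ∈ k20I` on `10, 11, 12`), and the FINAL CHECK ★ `rowCFinalCheckB c B pi ends xshi b` asks the centred upper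
bounds of `rowCE xshi b` and of `1 − P̂` to be `≤ 0` (Krawczyk–Neumaier slope evaluation `sdEnclose`, moving coordinates
`(ν, a)`).  Soundness: ★ `rowC_coreSlope` (the conclusion of `RowC.rowC_core`, verbatim) and ★★★ `offPoleTail_of_partsSlope` (the
conclusion of `RowC.offPoleTail_of_rowCCheck`, verbatim: `‖R′‖² − polePart − lowNormPart ≤ b·η_eff·(2ε₁ − T⁺)·U` for every
`L ≥ 128` and every ground profile of the cell), from the literal-box identity, the 22 part checks, the final check, the column
certificates `c.check`, `xsCellCheck … xshi` and the window-shell majorant `hZ` — so a first-order row-C cell costs ONE more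
kernel `decide` (≈ 20 s) on top of a landed first-order row-`N₁` cell.
Prover seat `hubbard-h0-rotor-p2` g6; helper for piece A = stmt-HubbardSuperconductivity-23918 of rung 19089
(`--supports`, helper class), offered to the route lead's row-C campaign (p1 g28–g29).  WHAT THIS IS NOT: nothing here proves
superconductivity in the Hubbard model, nor the crux: it reduces the KT-2b row for all `L ≥ 128` on a cell to kernel checks plus
p1's window lemma; the rotor TARGET as originally worded stays FALSE (g15 verdict).  Tree imports only; no sorry.
-/

set_option linter.dupNamespace false
set_option autoImplicit false

open Literature.Analysis.ValidatedNumerics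

namespace Summit.HubbardSuperconductivity.HubbardSuperconductivity.Theorems.AnisotropyChord.Transfer.Fibre3

namespace RowC

open L2 L2.N1

/-! ## The first-order row-C final check (computable) -/

/-- a rational pair as an interval (degenerate pairs collapse to a point). -/
def ivP (p : ℚ × ℚ) : NonemptyInterval ℚ := ivQ p.1 p.2

/-- ★ the row-C final-stage environment: p2's `envF` on `0…9`, then the still coordinates `x₄ ∈ c.bS2` (10), `k₁₁ ∈ k11I` (11),
`k₂₀ ∈ k20I` (12), and `0` beyond. -/
def envR (c : L2.NamedCell) (XS : ℕ → SD) (objs : List SD) : ℕ → SD := fun i =>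
  if i < 10 then envF XS objs i
  else if i = 10 then SD.still (ivP c.bS2) else if i = 11 then SD.still (ivP k11I) else if i = 12 then SD.still (ivP k20I)
  else SD.const 0

/-- ★ THE FIRST-ORDER ROW-C FINAL CHECK on a literal staged box `B` with end data `ends`: centred upper bounds of
`rowCE xshi b` (`≤ 0`) and of `−P̂` (`≤ −1`). -/
def rowCFinalCheckB (c : L2.NamedCell) (B : Box) (pi : ℕ × ℕ) (ends : List (SD × SD)) (xshi bC : ℚ) : Bool :=
  let XR := envR c (envC B) (ends.map fun p => p.1.hull p.2)
  let D2 := incrI (B.toIvl 2) (midI (B.toIvl 2))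
  let D3 := incrI (B.toIvl 3) (midI (B.toIvl 3))
  match sdEnclose pi.1 pi.2 XR (rowCE xshi bC), sdEnclose pi.1 pi.2 XR (.neg yP) with
  | some M, some P => decide (M.ub D2 D3 ≤ 0) && decide (P.ub D2 D3 ≤ -1)
  | _, _ => false

/-! ## Soundness -/

/-- membership in `ivP`. -/
theorem mem_ivP {p : ℚ × ℚ} {x : ℝ} (h : ((p.1 : ℚ) : ℝ) ≤ x ∧ x ≤ ((p.2 : ℚ) : ℝ)) : x ∈ (ivP p).ratCast ℝ := by
  have hle : p.1 ≤ p.2 := by exact_mod_cast h.1.trans h.2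
  unfold ivP ivQ
  rw [dif_pos hle]
  exact memQ.2 h

variable (L : ℕ) [NeZero L]

/-- ★ the final-stage pair of a first-order cell: for the true vector `X` of a ground profile in the cell and its five object
values, the environment `envF (envC B) (hulls of endsOfParts)` encloses the pair `(finalVec X vs, finalVec (cenPt B x₁) ws)` for the
truncation `x₁` of `X` and suitable centre companions `ws` (the argument inside `cellCheckS_sound`, exposed). [folklore] -/
theorem finalPair_of_partsSlope {c : L2.NamedCell} {a1 a2 : ℚ} {pi : ℕ × ℕ} {B : Box} {d : PD}
    (hbox : cellBox c a1 a2 2 pi = some B) (hparts : PartsOK B pi d) (X : ℕ → ℝ) (hX : PMem (c.box a1 a2) X)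
    (hsp : ∀ j (hj : j < (specs 2).length), ((specs 2)[j].1).eval X ≤ X (16 + j) ∧ X (16 + j) ≤ ((specs 2)[j].2).eval X)
    (vs : List ℝ) (hvl : vs.length = 5)
    (hob : ∀ j (hj : j < (objSpecsC 2).length) (hj' : j < vs.length),
      ((objSpecsC 2)[j].1).eval X ≤ vs[j] ∧ vs[j] ≤ ((objSpecsC 2)[j].2).eval X) :
    ∃ (x₁ : ℕ → ℝ) (ws : List ℝ), B.mem x₁ ∧ (∀ i, i < B.length → X i = x₁ i) ∧ 17 ≤ B.length ∧
      ∀ i, (envF (envC B) ((endsOfParts pi.1 d).map fun p => p.1.hull p.2) i).Holds (x₁ 2 - midI (B.toIvl 2))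
        (x₁ 3 - midI (B.toIvl 3)) (finalVec X vs i) (finalVec (cenPt B x₁) ws i) := by
  have hlen0 : (c.box a1 a2).length = 16 := by simp [L2.NamedCell.box]
  have hv := specsVarsOkC_two
  simp only [specsVarsOkC, Bool.and_eq_true] at hv
  obtain ⟨hv1, hv2⟩ := hv
  have hS : SpecsHold X (c.box a1 a2).length (specs 2) := by
    rw [hlen0]; exact specsHold_of X (specs 2) 16 hv1 hsp
  have hB' := hbox
  unfold cellBox at hB'
  obtain ⟨hPB, hlenB⟩ := extendBox_sound pi.1 pi.2 X (specs 2) _ B hB' hX hS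
  have hn17 : 17 ≤ B.length := by
    rw [hlenB, hlen0]; simp only [specs, List.length_append, List.length_cons, List.length_nil, List.length_map]; omega
  obtain ⟨x₁, hx₁⟩ : ∃ x₁ : ℕ → ℝ, x₁ = trunc X B.length := ⟨_, rfl⟩
  have hmem : B.mem x₁ := by rw [hx₁]; exact mem_trunc hPB
  have hXeq : ∀ i, i < B.length → X i = x₁ i := fun i hi => by rw [hx₁]; unfold trunc; rw [if_pos hi]
  have hcen : ∀ i, i ≠ 2 → i ≠ 3 → cenPt B x₁ i = x₁ i := fun i h2 h3 => by
    unfold cenPt; rw [Function.update_of_ne h3, Function.update_of_ne h2]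
  have hvars : ∀ j (hj : j < (objSpecsC 2).length), varsBelow B.length ((objSpecsC 2)[j].1) = true ∧
      varsBelow B.length ((objSpecsC 2)[j].2) = true := by
    intro j hj
    rw [hlenB, hlen0]
    have := List.all_eq_true.1 hv2 _ (List.getElem_mem hj)
    simpa [Bool.and_eq_true] using this
  have hob₁ : ∀ j (hj : j < (objSpecsC 2).length) (hj' : j < vs.length),
      ((objSpecsC 2)[j].1).eval x₁ ≤ vs[j] ∧ vs[j] ≤ ((objSpecsC 2)[j].2).eval x₁ := by
    intro j hj hj'
    obtain ⟨hva, hvb⟩ := hvars j hj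
    rw [hx₁, eval_trunc _ hva, eval_trunc _ hvb]
    exact hob j hj hj'
  have hends := ends_of_parts hbox hparts
  have hends₁ : ∀ j (hj : j < (objSpecsC 2).length) (hj' : j < (endsOfParts pi.1 d).length),
      ((endsOfParts pi.1 d)[j].1).Holds (x₁ 2 - midI (B.toIvl 2)) (x₁ 3 - midI (B.toIvl 3)) (((objSpecsC 2)[j].1).eval x₁)
        (((objSpecsC 2)[j].1).eval (cenPt B x₁)) ∧
      ((endsOfParts pi.1 d)[j].2).Holds (x₁ 2 - midI (B.toIvl 2)) (x₁ 3 - midI (B.toIvl 3)) (((objSpecsC 2)[j].2).eval x₁)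
        (((objSpecsC 2)[j].2).eval (cenPt B x₁)) := by
    intro j hj hj'
    obtain ⟨h1, h2⟩ := hends j hj hj'
    exact ⟨h1 B hbox x₁ hmem, h2 B hbox x₁ hmem⟩
  obtain ⟨ws, hws, hobjs⟩ := holds_objs (x := x₁) (z := cenPt B x₁) (objSpecsC 2) (endsOfParts pi.1 d) vs
    (by simp [objSpecsC, endsOfParts]) (by rw [hvl]; simp [objSpecsC]) hends₁ hob₁
  refine ⟨x₁, ws, hmem, hXeq, hn17, fun i => ?_⟩
  unfold envF
  by_cases h4 : i < 4
  · rw [if_pos h4]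
    have hyi : finalVec X vs i = x₁ i := by
      unfold finalVec
      interval_cases i <;> simp [hXeq 0 (by omega), hXeq 1 (by omega), hXeq 2 (by omega), hXeq 3 (by omega)]
    have hyzi : finalVec (cenPt B x₁) ws i = cenPt B x₁ i := by
      unfold finalVec
      interval_cases i <;> simp
    rw [hyi, hyzi]; exact holds_envC hmem i
  · rw [if_neg h4]
    by_cases h5 : i = 4
    · subst h5
      rw [if_pos rfl]
      have hyi : finalVec X vs 4 = x₁ 16 := by unfold finalVec; simp [hXeq 16 (by omega)]
      have hyzi : finalVec (cenPt B x₁) ws 4 = x₁ 16 := by unfold finalVec; simp [hcen 16 (by decide) (by decide)]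
      rw [hyi, hyzi]
      have h16 := holds_envC hmem 16
      rw [hcen 16 (by decide) (by decide)] at h16
      exact h16
    · rw [if_neg h5]
      have hyi : finalVec X vs i = vs.getD (i - 5) 0 := by
        unfold finalVec
        simp [show i ≠ 0 by omega, show i ≠ 1 by omega, show i ≠ 2 by omega, show i ≠ 3 by omega, h5]
      have hyzi : finalVec (cenPt B x₁) ws i = ws.getD (i - 5) 0 := by
        unfold finalVec
        simp [show i ≠ 0 by omega, show i ≠ 1 by omega, show i ≠ 2 by omega, show i ≠ 3 by omega, h5]
      rw [hyi, hyzi]; exact hobjs (i - 5)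

/-- ★ CORE (first order): the literal-box identity, the part checks and a passing first-order row-C final check give, at the
ground profile, `P̂ > 0` and the evaluated row inequality — the conclusion of `rowC_core` verbatim. [folklore] -/
theorem rowC_coreSlope (c : L2.NamedCell) (a1 a2 xshi bC : ℚ) (pi : ℕ × ℕ) (B : Box) (d : PD)
    (hbox : cellBox c a1 a2 2 pi = some B) (hparts : PartsOK B pi d)
    (hfin : rowCFinalCheckB c B pi (endsOfParts pi.1 d) xshi bC = true) (hc : c.check = true) (hL : 128 ≤ L)
    {Δ lam2 : ℝ} {f : Tor L → ℝ} (hΔ0 : 0 ≤ Δ) (hΔ1 : Δ < 1) (hf : IsGroundTwoMagnon L Δ lam2 f)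
    (hν1 : (c.n1 : ℝ) / c.νd ≤ lam2 / (2 * Real.pi / L) ^ 2) (hν2 : lam2 / (2 * Real.pi / L) ^ 2 ≤ (c.n2 : ℝ) / c.νd)
    (ha1 : ((a1 : ℚ) : ℝ) ≤ Δ * f (K1 L)) (ha2 : Δ * f (K1 L) ≤ ((a2 : ℚ) : ℝ)) :
    let t : ℝ := (2 * Real.pi / L) ^ 2
    let vP : ℝ := t ^ 3 * ∑ k : Tor L, F2 L f k ^ 3
    let vQ : ℝ := t ^ 2 * ∑ k : Tor L, nK L f k * F2 L f k
    0 < vP ∧ t ^ 2 * S2n L lam2 ≤ ((c.bS2.2 : ℚ) : ℝ) ∧ t ^ 2 * T10n L lam2 ≤ ((c.bT10.2 : ℚ) : ℝ) ∧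
    9 * (Real.sqrt (ChiN t (lam2 / t) (Δ * f (K1 L)) (eps1 L / t) (t ^ 2 * S2n L lam2) xshi)
        + Real.sqrt (NhiN t (lam2 / t) (Δ * f (K1 L)) (t ^ 2 * S2n L lam2) (aKer L lam2 (ex L + ey L))
            (aKer L lam2 (ex L + ex L)) (ZwN t (lam2 / t) (Δ * f (K1 L))))) ^ 2
      - 48 * (Real.pi ^ 2) ^ 2 * bC * (Real.pi ^ 2 * (lam2 / t)) * (2 * (eps1 L / t) - (3 * (lam2 / t) - 3 / 2 * vQ * vP⁻¹))
          * (3 * (lam2 / t) - 3 / 2 * vQ * vP⁻¹) ≤ 0 := by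
  classical
  intro t vP vQ
  set X := xTrue L Δ lam2 f (Δ * f (K1 L)) with hXdef
  have hLpos : (0 : ℝ) < L := by exact_mod_cast (show 0 < L by omega)
  have hπ := Real.pi_pos
  have ht0 : 0 < t := by positivity
  -- regime facts (as in `rowC_core`)
  have hlam : 0 < lam2 := lam2_pos L (by omega) hΔ1 hf.1
  have h2 : 2 * lam2 < eps1 L := two_lam2_lt_eps1 L (by omega) hΔ0 hf
  obtain ⟨ha0, haV, _, _⟩ := ManifoldA.manifold_band L hL hΔ0 hΔ1 hf
  have hνc := ManifoldA.nu_ceiling L hL hΔ0 hf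
  have hν4 : lam2 / (2 * Real.pi / L) ^ 2 < 4 / Real.pi ^ 2 := by
    rw [div_lt_iff₀ ht0]
    have hπ2 : Real.pi ^ 2 < 10 := by nlinarith [Real.pi_lt_d2, Real.pi_pos]
    have : (0.031 : ℝ) ≤ 4 / Real.pi ^ 2 := by rw [le_div_iff₀ (by positivity)]; nlinarith
    nlinarith
  have hV1 : (1 : ℝ) / (L : ℝ) ^ 2 = t * (4 * Real.pi ^ 2)⁻¹ := by
    show (1 : ℝ) / (L : ℝ) ^ 2 = (2 * Real.pi / L) ^ 2 * (4 * Real.pi ^ 2)⁻¹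
    field_simp; ring
  have hu' : 0 < 1 - Δ * f (K1 L) + Δ * f (K1 L) * ((2 * Real.pi / L) ^ 2 * (4 * Real.pi ^ 2)⁻¹) := by
    have : (2 * Real.pi / (L : ℝ)) ^ 2 * (4 * Real.pi ^ 2)⁻¹ = 1 / (L : ℝ) ^ 2 := hV1.symm
    rw [this]; nlinarith
  obtain ⟨_, _, _, _, d5, _, _⟩ := ManifoldA.manifold_dictionary L (by omega) hΔ0 hΔ1 hf
  have hu : 0 < cS L Δ lam2 f * Gzero L lam2 := by
    rw [← Gres_zero_zero_eq_Gzero, d5]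
    have : Δ * f (K1 L) / (L : ℝ) ^ 2 = Δ * f (K1 L) * ((2 * Real.pi / L) ^ 2 * (4 * Real.pi ^ 2)⁻¹) := by
      rw [← hV1]; ring
    rw [this]; exact hu'
  -- the true vector and its objects
  have hPM : PMem (c.box a1 a2) X := pmem_xTrue c hc a1 a2 L hL Δ lam2 f _ hν1 hν2 ha1 ha2
  have hsp := xTrue_specs_ground L Δ lam2 f (by omega) hΔ0 hΔ1 hf hlam h2 hν4 ha0 hu'
  set vB : ℝ := ((2 * Real.pi / L) ^ 2) ^ 3 * ∑ k : Tor L, F2 L f k ^ 2 * F2 L f (k + K1 L) with hvB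
  set vA : ℝ := ((2 * Real.pi / L) ^ 2) ^ 2 * ∑ k : Tor L, F2 L f k ^ 2 * cosx L k with hvA
  set vJ : ℝ := ((2 * Real.pi / L) ^ 2) ^ 2 * ∑ k : Tor L, bcJ L f k with hvJ
  have oB := bHat_mem L Δ lam2 f (by omega) hΔ0 hΔ1 hf hlam h2 hu
  have oP := pHat_mem L Δ lam2 f (by omega) hΔ0 hΔ1 hf hlam h2 hu
  have oA := aHat_mem L Δ lam2 f (by omega) hΔ0 hΔ1 hf hlam h2 hu
  have oQ := q1Hat_mem L Δ lam2 f (by omega) hΔ0 hΔ1 hf hlam h2 hu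
  have oJ := j1Hat_mem L Δ lam2 f (by omega) hΔ0 hΔ1 hf hlam h2 hu
  have hob : ∀ j (hj : j < (objSpecsC 2).length) (hj' : j < [vB, vP, vA, vQ, vJ].length),
      ((objSpecsC 2)[j].1).eval X ≤ [vB, vP, vA, vQ, vJ][j] ∧ [vB, vP, vA, vQ, vJ][j] ≤ ((objSpecsC 2)[j].2).eval X := by
    intro j hj hj'
    have hj5 : j < 5 := by simpa [objSpecsC] using hj
    interval_cases j
    · simpa [objSpecsC] using oB
    · simpa [objSpecsC] using oP
    · simpa [objSpecsC] using oA
    · simpa [objSpecsC] using oQ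
    · simpa [objSpecsC] using oJ
  have hlen0 : (c.box a1 a2).length = 16 := by simp [L2.NamedCell.box]
  -- the first-order interval layer
  obtain ⟨x₁, ws, hmem, hXeq, hn17, hXF⟩ := finalPair_of_partsSlope hbox hparts X hPM hsp [vB, vP, vA, vQ, vJ] rfl hob
  obtain ⟨y0, y1, y2, y3, y4, y5, y6, y7, y8, y9⟩ := finalVec_vals X vB vP vA vQ vJ
  -- coordinates of `X`
  have hX0 : X 0 = t := xTrue_zero L Δ lam2 f _
  have hX1 : X 1 = Real.pi ^ 2 := by rw [hXdef, xTrue_lt16 L Δ lam2 f _ (by norm_num)]; rfl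
  have hX2 : X 2 = lam2 / t := by rw [hXdef, xTrue_lt16 L Δ lam2 f _ (by norm_num)]; rfl
  have hX3 : X 3 = Δ * f (K1 L) := by rw [hXdef, xTrue_lt16 L Δ lam2 f _ (by norm_num)]; rfl
  have hX4 : X 4 = t ^ 2 * S2n L lam2 := by
    rw [hXdef, xTrue_lt16 L Δ lam2 f _ (by norm_num)]
    show (2 * Real.pi / L) ^ (2 * 2) * S2n L lam2 = _
    ring
  have hX7 : X 7 = t ^ 2 * T10n L lam2 := by
    rw [hXdef, xTrue_lt16 L Δ lam2 f _ (by norm_num)]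
    show (2 * Real.pi / L) ^ (2 * 2) * T10n L lam2 = _
    ring
  have hX16 : X 16 = eps1 L / t := by rw [hXdef, xTrue_16]; rfl
  -- the brackets of `x₄`, `x₇` from the column box
  have hB4 := hPM 4 (by rw [hlen0]; norm_num)
  have hB7 := hPM 7 (by rw [hlen0]; norm_num)
  have e4 : (c.box a1 a2).ivl 4 = c.bS2 := by simp [L2.NamedCell.box, Box.ivl]
  have e7 : (c.box a1 a2).ivl 7 = c.bT10 := by simp [L2.NamedCell.box, Box.ivl]
  rw [e4, hX4] at hB4
  rw [e7, hX7] at hB7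
  obtain ⟨h11, h20⟩ := window_k11_k20 L hL hΔ0 hΔ1 hf
  -- the extended pair
  set y' := extVec (finalVec X [vB, vP, vA, vQ, vJ]) (t ^ 2 * S2n L lam2) (aKer L lam2 (ex L + ey L))
    (aKer L lam2 (ex L + ex L)) with hy'
  set yz' := extVec (finalVec (cenPt B x₁) ws) (t ^ 2 * S2n L lam2) (aKer L lam2 (ex L + ey L))
    (aKer L lam2 (ex L + ex L)) with hyz'
  have hXR : ∀ i, (envR c (envC B) ((endsOfParts pi.1 d).map fun p => p.1.hull p.2) i).Holds (x₁ 2 - midI (B.toIvl 2))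
      (x₁ 3 - midI (B.toIvl 3)) (y' i) (yz' i) := by
    intro i
    unfold envR
    by_cases h10 : i < 10
    · rw [if_pos h10]
      have e1 : y' i = finalVec X [vB, vP, vA, vQ, vJ] i := by rw [hy']; unfold extVec; rw [if_pos h10]
      have e2 : yz' i = finalVec (cenPt B x₁) ws i := by rw [hyz']; unfold extVec; rw [if_pos h10]
      rw [e1, e2]; exact hXF i
    rw [if_neg h10]
    by_cases i10 : i = 10
    · subst i10
      rw [if_pos rfl]
      have e1 : y' 10 = t ^ 2 * S2n L lam2 := by simp [hy', extVec]
      have e2 : yz' 10 = t ^ 2 * S2n L lam2 := by simp [hyz', extVec]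
      rw [e1, e2]; exact SD.still_holds (mem_ivP hB4)
    rw [if_neg i10]
    by_cases i11 : i = 11
    · subst i11
      rw [if_pos rfl]
      have e1 : y' 11 = aKer L lam2 (ex L + ey L) := by simp [hy', extVec]
      have e2 : yz' 11 = aKer L lam2 (ex L + ey L) := by simp [hyz', extVec]
      rw [e1, e2]; exact SD.still_holds (mem_ivP h11)
    rw [if_neg i11]
    by_cases i12 : i = 12
    · subst i12
      rw [if_pos rfl]
      have e1 : y' 12 = aKer L lam2 (ex L + ex L) := by simp [hy', extVec]
      have e2 : yz' 12 = aKer L lam2 (ex L + ex L) := by simp [hyz', extVec]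
      rw [e1, e2]; exact SD.still_holds (mem_ivP h20)
    rw [if_neg i12]
    have e1 : y' i = 0 := by rw [hy']; unfold extVec; rw [if_neg h10, if_neg i10, if_neg i11, if_neg i12]
    have e2 : yz' i = 0 := by rw [hyz']; unfold extVec; rw [if_neg h10, if_neg i10, if_neg i11, if_neg i12]
    rw [e1, e2]; exact_mod_cast SD.const_holds (δ2 := x₁ 2 - midI (B.toIvl 2)) (δ3 := x₁ 3 - midI (B.toIvl 3)) 0
  have hD2 := incr_mem hmem 2
  have hD3 := incr_mem hmem 3
  unfold rowCFinalCheckB at hfin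
  simp only at hfin
  split at hfin
  · rename_i M P hM hP
    simp only [Bool.and_eq_true, decide_eq_true_eq] at hfin
    obtain ⟨hM0, hP0⟩ := hfin
    have eR := (sdEnclose_bounds hXR hD2 hD3 _ hM).2
    have eP1 := (sdEnclose_bounds hXR hD2 hD3 _ hP).2
    have eR' : (rowCE xshi bC).eval y' ≤ 0 := eR.trans (by exact_mod_cast hM0)
    have eP1' : (RExpr.neg yP).eval y' ≤ ((-1 : ℚ) : ℝ) := eP1.trans (by exact_mod_cast hP0)
    -- coordinates of `y'`
    have g0 : y' 0 = t := by simp [hy', extVec, y0, hX0]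
    have g1 : y' 1 = Real.pi ^ 2 := by simp [hy', extVec, y1, hX1]
    have g2 : y' 2 = lam2 / t := by simp [hy', extVec, y2, hX2]
    have g3 : y' 3 = Δ * f (K1 L) := by simp [hy', extVec, y3, hX3]
    have g4 : y' 4 = eps1 L / t := by simp [hy', extVec, y4, hX16]
    have g6 : y' 6 = vP := by simp [hy', extVec, y6]
    have g8 : y' 8 = vQ := by simp [hy', extVec, y8]
    have g10 : y' 10 = t ^ 2 * S2n L lam2 := by simp [hy', extVec]
    have g11 : y' 11 = aKer L lam2 (ex L + ey L) := by simp [hy', extVec]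
    have g12 : y' 12 = aKer L lam2 (ex L + ex L) := by simp [hy', extVec]
    rw [eval_rowCE y' g1 xshi bC, g0, g2, g3, g4, g6, g8, g10, g11, g12] at eR'
    simp only [yP, RExpr.eval, Rat.cast_neg, Rat.cast_one] at eP1'
    rw [g6] at eP1'
    exact ⟨by linarith, hB4.2, hB7.2, eR'⟩
  · exact absurd hfin (by simp)

/-- ★★★ **A PASSING FIRST-ORDER ROW-C CHECK GIVES THE OFF-POLE TAIL BOUND FOR EVERY `L ≥ 128` ON THE CELL** — the
conclusion of `offPoleTail_of_rowCCheck`, from the literal staged box identity, the 22 part checks of the first-order row-`N₁`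
cell, the first-order row-C final check, the column certificates and the window-shell majorant. -/
theorem offPoleTail_of_partsSlope (c : L2.NamedCell) (a1 a2 xshi bC : ℚ) (pi : ℕ × ℕ) (Dxs : ℕ) (B : Box) (d : PD)
    (hbox : cellBox c a1 a2 2 pi = some B) (hparts : PartsOK B pi d)
    (hfin : rowCFinalCheckB c B pi (endsOfParts pi.1 d) xshi bC = true) (hc : c.check = true)
    (hxs : xsCellCheck 128 c.n1 c.n2 c.νd c.Tn c.Td Dxs c.bS2.2 c.bT10.2 xshi = true)
    (hZ : ∀ (Δ' lam2' : ℝ) (f' : Tor L → ℝ), 0 ≤ Δ' → Δ' < 1 → IsGroundTwoMagnon L Δ' lam2' f' →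
      (∑ b ∈ shellWin L, C0fn L Δ' lam2' f' (ex L, b) ^ 2)
        ≤ ZwN ((2 * Real.pi / L) ^ 2) (lam2' / (2 * Real.pi / L) ^ 2) (Δ' * f' (K1 L)))
    (hL : 128 ≤ L)
    {Δ lam2 : ℝ} {f : Tor L → ℝ} (hΔ0 : 0 ≤ Δ) (hΔ1 : Δ < 1) (hf : IsGroundTwoMagnon L Δ lam2 f)
    (hν1 : (c.n1 : ℝ) / c.νd ≤ lam2 / (2 * Real.pi / L) ^ 2) (hν2 : lam2 / (2 * Real.pi / L) ^ 2 ≤ (c.n2 : ℝ) / c.νd)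
    (ha1 : ((a1 : ℚ) : ℝ) ≤ Δ * f (K1 L)) (ha2 : Δ * f (K1 L) ≤ ((a2 : ℚ) : ℝ)) :
    (ip L (resid L Δ f) (resid L Δ f)).re - polePart L Δ f - lowNormPart L Δ f
      ≤ (bC : ℝ) * etaEff L lam2 * (2 * eps1 L - Tplus L Δ f) * Uunit L Δ f := by
  have hLpos : (0 : ℝ) < L := by exact_mod_cast (show 0 < L by omega)
  have hπ := Real.pi_pos
  have hL2 : 2 ≤ L := by omega
  set t : ℝ := (2 * Real.pi / L) ^ 2 with ht
  have ht0 : 0 < t := by positivity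
  obtain ⟨hvP0, hx4, hx7, eR⟩ := rowC_coreSlope L c a1 a2 xshi bC pi B d hbox hparts hfin hc hL hΔ0 hΔ1 hf hν1 hν2 ha1 ha2
  have hT := Tplus_eq_tau L hL2 hf hvP0
  rw [← ht] at hvP0 hx4 hx7 eR hT
  set vP : ℝ := t ^ 3 * ∑ k : Tor L, F2 L f k ^ 3 with hvP
  set vQ : ℝ := t ^ 2 * ∑ k : Tor L, nK L f k * F2 L f k with hvQ
  have hlamθ : lam2 = lam2 / t * (2 * Real.pi / L) ^ 2 := by rw [ht]; field_simp
  have hXS : XSn L lam2 ≤ ((xshi : ℚ) : ℝ) := by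
    have h := xs_cell_sound 128 c.n1 c.n2 c.νd c.Tn c.Td Dxs c.bS2.2 c.bT10.2 xshi hxs L hL (lam2 / t)
      (by rw [ht]; exact hν1) (by rw [ht]; exact hν2)
      (by rw [← hlamθ, ← ht]; exact hx4) (by rw [← hlamθ, ← ht]; exact hx7)
    rw [← hlamθ] at h; exact h
  have hChi := cs2_le_ChiN L hL hΔ0 hΔ1 hf ((xshi : ℚ) : ℝ) hXS
  have hNhi := nC0p_le_NhiN L hL hΔ0 hΔ1 hf _ (hZ Δ lam2 f hΔ0 hΔ1 hf)
  rw [← ht] at hChi hNhi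
  obtain ⟨_, _, _, _, _, _, d7⟩ := ManifoldA.manifold_dictionary L (by omega) hΔ0 hΔ1 hf
  have hVθ : ((L : ℝ) ^ 2) = 4 * Real.pi ^ 2 / t := by rw [ht]; field_simp; ring
  have hRHS : (bC : ℝ) * etaEff L lam2 * (2 * eps1 L - Tplus L Δ f) * Uunit L Δ f
      = 48 * (Real.pi ^ 2) ^ 2 * bC * (Real.pi ^ 2 * (lam2 / t))
          * (2 * (eps1 L / t) - (3 * (lam2 / t) - 3 / 2 * vQ * vP⁻¹)) * (3 * (lam2 / t) - 3 / 2 * vQ * vP⁻¹) := by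
    unfold Uunit
    rw [d7, ← ht, hT, hVθ]
    field_simp
    ring
  have hmirror : ∀ r : Tor L, f (-r.1, r.2) = f r := ground_mirror L hL2 hf
  have hpieces := offPoleTailFromPieces_holds L hL2 Δ lam2 f hf hmirror
  have hP0 := polePartNonneg_holds L Δ f
  have hN0 := lowNormPartNonneg_holds L Δ f
  have hsq : (3 * Real.sqrt (cs2 L f) + 3 * Real.sqrt (nC0p L Δ f)) ^ 2
      ≤ 9 * (Real.sqrt (ChiN t (lam2 / t) (Δ * f (K1 L)) (eps1 L / t) (t ^ 2 * S2n L lam2) xshi)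
        + Real.sqrt (NhiN t (lam2 / t) (Δ * f (K1 L)) (t ^ 2 * S2n L lam2)
            (aKer L lam2 (ex L + ey L)) (aKer L lam2 (ex L + ex L)) (ZwN t (lam2 / t) (Δ * f (K1 L))))) ^ 2 := by
    have s1 := Real.sqrt_le_sqrt hChi
    have s2 := Real.sqrt_le_sqrt hNhi
    have e : (3 * Real.sqrt (cs2 L f) + 3 * Real.sqrt (nC0p L Δ f)) ^ 2
        = 9 * (Real.sqrt (cs2 L f) + Real.sqrt (nC0p L Δ f)) ^ 2 := by ring
    rw [e]
    apply mul_le_mul_of_nonneg_left _ (by norm_num)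
    apply pow_le_pow_left₀ (by positivity)
    linarith
  rw [hRHS]
  linarith [hpieces, hP0, hN0, hsq, eR]

end RowC

end Summit.HubbardSuperconductivity.HubbardSuperconductivity.Theorems.AnisotropyChord.Transfer.Fibre3
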